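import Mathlib.Analysis.Complex.ExponentialBounds
import Literature.NumberTheory.LFunctions.DeBruijnPhiLogDerivEnvelope
import Summits.RiemannHypothesis.RiemannHypothesis.Theorems.JensenPolynomialsPhiHigherDeriv
import HarnessLib

/-!
# Route `JensenPolynomials`, far skewness crux `XiCumulantSkew98Far` — theta tails of degree `≤ 6` and the heads of
`Φ″`, `Φ‴`, `Φ⁗` (RH-FREE; cell rh-jensen, HUMAN RULING D-0040 / D-0074)

LINE 1 (D-0074 framing): everything here is RH-FREE real analysis of the Pólya–de Bruijn kernel `Φ = deBruijnPhi`;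
nothing in this file bears on the zeros of `ζ` or is progress toward RH.

Companion of `JensenPolynomialsPhiLogDeriv34.lean` (objects `ψ‴`, `ψ⁗`) and toolbox of
`JensenPolynomialsPhiLogDerivEnvelope34.lean` (the envelopes (E3)/(E4) of BLUEPRINT-19216 §5). The tree's
`DeBruijnPhiThetaTails.lean` bounds the `n ≥ 1` tails of the one-series `Φ^{(m)}(u) = eᵘ∑_n P_m(y_n)e^{−y_n}`
(`y_n = π(n+1)²e^{4u}`) for degree `≤ 4` (`Φ, Φ′, Φ″`); the third and fourth derivatives
(`deBruijnPhiDeriv₃_eq_tsum`, `deBruijnPhiDeriv₄_eq_tsum`, generic term `phiPolyTerm6`) have degree `5` and `6`.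
We prove, in the same way (Coffey–Csordas 2013, Proposition 2.1, (2.5)–(2.6): `y_{n+1} = (n+2)²y`,
`(n+2)^{2d} ≤ 4^d4^{dn}`, `e^{−((n+2)²−4)y} ≤ e^{−4πn}`, now with `4^d e^{−4π} ≤ 4096/23⁴ < 1/64`):

* `thetaFreq_succ_pow_mul_exp_le6`, `tsum_thetaFreq_succ_pow_mul_exp_le6`: for `x ≥ 1`, `d ≤ 6`,
  `∑_{n≥0} y_{n+1}^d e^{−y_{n+1}} ≤ (64/63)·4^d·y^d e^{−4y}` (`y = πx`);
* `abs_tsum_phiPolyTerm6_succ_le`: `|∑_{n≥1} P(y_n)e^{−y_n}| ≤ C·(64/63)·4^d·y^d e^{−4y}` whenever `|P(z)| ≤ Cz^d` on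
  `z ≥ 4π`, and its instances for `P₀, P₁, P₂, P₃, P₄` (`C = 2, 8, 32, 128, 512`, `d = 2, …, 6`);
* the heads `P₂(y)e^{−y}`, `P₃(y)e^{−y}`, `P₄(y)e^{−y}` at `n = 0` in closed form.

WHAT THIS IS NOT: not a statement about `ξ`'s zeros. References: M. W. Coffey, G. Csordas, Math. Comp. 82 (2013),
Proposition 2.1 and (2.9)–(2.11) [CoffeyCsordas2013].
-/

noncomputable section

open Filter Set
open scoped Real Topology

-- D-0017: `Summit.RiemannHypothesis.RiemannHypothesis.…` duplicates the namespace BY DESIGN (single-problem summit).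
set_option linter.dupNamespace false

namespace Summit.RiemannHypothesis.RiemannHypothesis.Theorems.JensenPolynomials

open Literature.NumberTheory.LFunctions

/-! ## 1. Theta tails of degree `≤ 6` -/

/-- `e^{−4π} < 1/279841 = 1/23⁴`. -/
theorem exp_neg_four_pi_lt' : rexp (-(4 * π)) < 1 / 279841 := by
  have h : rexp (-(4 * π)) = rexp (-π) ^ 4 := by
    rw [← Real.exp_nat_mul]; congr 1; push_cast; ring
  rw [h]
  have h0 := (Real.exp_pos (-π)).le
  calc rexp (-π) ^ 4 < (1 / 23) ^ 4 := by gcongr; exact wintner_exp_neg_pi_lt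
    _ = 1 / 279841 := by norm_num

/-- The frequency of index `n + 1` in closed form: `y_{n+1} = (n+2)²·πx`. -/
theorem thetaFreq_succ_eq' (x : ℝ) (n : ℕ) : thetaFreq x (n + 1) = ((n : ℝ) + 2) ^ 2 * (π * x) := by
  simp only [thetaFreq]; push_cast; ring

/-- `y_{n+1} ≥ 4πx` in the form used below: `4·(πx) ≤ thetaFreq x (n + 1)` for `x ≥ 0`. -/
theorem four_mul_le_thetaFreq_succ {x : ℝ} (hx : 0 ≤ x) (n : ℕ) : 4 * (π * x) ≤ thetaFreq x (n + 1) := by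
  rw [thetaFreq_succ_eq']
  have hn : (4 : ℝ) ≤ ((n : ℝ) + 2) ^ 2 := by nlinarith [(n.cast_nonneg : (0 : ℝ) ≤ n)]
  exact mul_le_mul_of_nonneg_right hn (mul_nonneg Real.pi_pos.le hx)

/-- `(n + 2)² ≤ 4·4ⁿ`. -/
theorem natCast_add_two_sq_le' (n : ℕ) : ((n : ℝ) + 2) ^ 2 ≤ 4 * 4 ^ n := by
  induction n with
  | zero => norm_num
  | succ k ih =>
    push_cast
    have h4 : (4 : ℝ) ^ (k + 1) = 4 ^ k * 4 := pow_succ 4 k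
    have hk : (0 : ℝ) ≤ k := k.cast_nonneg
    have h1 : ((k : ℝ) + 1 + 2) ^ 2 ≤ 4 * ((k : ℝ) + 2) ^ 2 := by nlinarith
    rw [h4]
    nlinarith [ih, h1]

/-- **The generic tail term, degree `≤ 6`**: for `x ≥ 1`, `y = πx` and `d ≤ 6`,
`y_{n+1}^d e^{−y_{n+1}} ≤ y^d e^{−4y}·4^d·(1/64)ⁿ` (`4^d e^{−4π} ≤ 4096/23⁴ < 1/64`).
(Coffey–Csordas 2013, Proposition 2.1, proof (2.5)–(2.6), two degrees further.) -/
theorem thetaFreq_succ_pow_mul_exp_le6 {x : ℝ} (hx : 1 ≤ x) {d : ℕ} (hd : d ≤ 6) (n : ℕ) :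
    thetaFreq x (n + 1) ^ d * rexp (-thetaFreq x (n + 1)) ≤
      (π * x) ^ d * rexp (-(4 * (π * x))) * 4 ^ d * (1 / 64) ^ n := by
  have hπ := Real.pi_gt_d2
  set y := π * x with hy
  have hy1 : π ≤ y := by rw [hy]; nlinarith [Real.pi_pos]
  have hy0 : 0 ≤ y := by linarith
  rw [thetaFreq_succ_eq', ← hy]
  have hpow : (((n : ℝ) + 2) ^ 2 * y) ^ d ≤ 4 ^ d * (4 ^ d) ^ n * y ^ d := by
    rw [mul_pow]
    have h1 : (((n : ℝ) + 2) ^ 2) ^ d ≤ (4 * 4 ^ n) ^ d := by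
      gcongr; exact natCast_add_two_sq_le' n
    calc (((n : ℝ) + 2) ^ 2) ^ d * y ^ d ≤ (4 * 4 ^ n) ^ d * y ^ d := by gcongr
      _ = 4 ^ d * (4 ^ d) ^ n * y ^ d := by rw [mul_pow, ← pow_mul, mul_comm n d, pow_mul]
  have hexp : rexp (-(((n : ℝ) + 2) ^ 2 * y)) ≤ rexp (-(4 * y)) * rexp (-(4 * π)) ^ n := by
    rw [← Real.exp_nat_mul, ← Real.exp_add]
    apply Real.exp_le_exp.2
    have hn : (0 : ℝ) ≤ n := n.cast_nonneg
    nlinarith [mul_nonneg hn hy0, mul_nonneg (mul_nonneg hn hn) hy0, mul_nonneg hn (sub_nonneg.2 hy1)]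
  have hratio : (4 : ℝ) ^ d * rexp (-(4 * π)) ≤ 1 / 64 := by
    have h4 : (4 : ℝ) ^ d ≤ 4096 := by
      calc (4 : ℝ) ^ d ≤ 4 ^ 6 := pow_le_pow_right₀ (by norm_num) hd
        _ = 4096 := by norm_num
    have := exp_neg_four_pi_lt'
    nlinarith [(Real.exp_pos (-(4 * π))).le]
  have hA : (0 : ℝ) ≤ 4 ^ d * (4 ^ d) ^ n * y ^ d := by positivity
  calc (((n : ℝ) + 2) ^ 2 * y) ^ d * rexp (-(((n : ℝ) + 2) ^ 2 * y))
      ≤ (4 ^ d * (4 ^ d) ^ n * y ^ d) * (rexp (-(4 * y)) * rexp (-(4 * π)) ^ n) :=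
        mul_le_mul hpow hexp (Real.exp_pos _).le hA
    _ = y ^ d * rexp (-(4 * y)) * 4 ^ d * (4 ^ d * rexp (-(4 * π))) ^ n := by rw [mul_pow]; ring
    _ ≤ y ^ d * rexp (-(4 * y)) * 4 ^ d * (1 / 64) ^ n := by
        have h0 : (0 : ℝ) ≤ 4 ^ d * rexp (-(4 * π)) := by positivity
        have h1 : (4 ^ d * rexp (-(4 * π))) ^ n ≤ (1 / 64 : ℝ) ^ n := pow_le_pow_left₀ h0 hratio n
        exact mul_le_mul_of_nonneg_left h1 (by positivity)

/-- Summing the generic tail, degree `≤ 6`: `∑_{n≥0} y_{n+1}^d e^{−y_{n+1}} ≤ (64/63)·4^d·y^d e^{−4y}` (`x ≥ 1`). -/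
theorem tsum_thetaFreq_succ_pow_mul_exp_le6 {x : ℝ} (hx : 1 ≤ x) {d : ℕ} (hd : d ≤ 6) :
    Summable (fun n => thetaFreq x (n + 1) ^ d * rexp (-thetaFreq x (n + 1))) ∧
    ∑' n, thetaFreq x (n + 1) ^ d * rexp (-thetaFreq x (n + 1)) ≤
      64 / 63 * 4 ^ d * ((π * x) ^ d * rexp (-(4 * (π * x)))) := by
  have hx0 : 0 ≤ x := zero_le_one.trans hx
  have hg : Summable fun n : ℕ => (π * x) ^ d * rexp (-(4 * (π * x))) * 4 ^ d * (1 / 64 : ℝ) ^ n :=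
    (summable_geometric_of_lt_one (by norm_num) (by norm_num)).mul_left _
  have hle := thetaFreq_succ_pow_mul_exp_le6 hx hd
  have hnn : ∀ n, 0 ≤ thetaFreq x (n + 1) ^ d * rexp (-thetaFreq x (n + 1)) := fun n =>
    mul_nonneg (pow_nonneg ((mul_nonneg Real.pi_pos.le hx0).trans (pi_mul_le_thetaFreq hx0 (n + 1))) d)
      (Real.exp_pos _).le
  have hs : Summable (fun n => thetaFreq x (n + 1) ^ d * rexp (-thetaFreq x (n + 1))) :=
    Summable.of_nonneg_of_le hnn hle hg
  refine ⟨hs, (hs.tsum_le_tsum hle hg).trans (le_of_eq ?_)⟩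
  rw [tsum_mul_left, tsum_geometric_of_lt_one (by norm_num) (by norm_num)]
  ring

/-- **The degree-six tails**: if `|P(z)| ≤ C z^d` for `z ≥ 4π` (`P(z) = a₁z + ⋯ + a₆z⁶`, `d ≤ 6`), then for `x ≥ 1`
`|∑_{n≥0} P(y_{n+1})e^{−y_{n+1}}| ≤ C·(64/63)·4^d·y^d e^{−4y}`, `y = πx`. (Coffey–Csordas 2013, Proposition 2.1, extended.) -/
theorem abs_tsum_phiPolyTerm6_succ_le {x : ℝ} (hx : 1 ≤ x) (a₁ a₂ a₃ a₄ a₅ a₆ C : ℝ) {d : ℕ} (hd : d ≤ 6)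
    (hP : ∀ z : ℝ, 4 * π ≤ z →
      |a₁ * z + a₂ * z ^ 2 + a₃ * z ^ 3 + a₄ * z ^ 4 + a₅ * z ^ 5 + a₆ * z ^ 6| ≤ C * z ^ d) :
    |∑' n, phiPolyTerm6 a₁ a₂ a₃ a₄ a₅ a₆ x (n + 1)| ≤
      C * (64 / 63 * 4 ^ d * ((π * x) ^ d * rexp (-(4 * (π * x))))) := by
  have hx0 : 0 < x := by linarith
  have hπ := Real.pi_pos
  obtain ⟨hsum, hle⟩ := tsum_thetaFreq_succ_pow_mul_exp_le6 hx hd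
  have hs : Summable fun n => phiPolyTerm6 a₁ a₂ a₃ a₄ a₅ a₆ x (n + 1) :=
    (summable_nat_add_iff 1).2 (summable_phiPolyTerm6 _ _ _ _ _ _ hx0)
  have hC : 0 ≤ C := by
    have h := hP (4 * π) le_rfl
    have h0 : (0 : ℝ) < (4 * π) ^ d := by positivity
    nlinarith [abs_nonneg (a₁ * (4 * π) + a₂ * (4 * π) ^ 2 + a₃ * (4 * π) ^ 3 + a₄ * (4 * π) ^ 4 +
      a₅ * (4 * π) ^ 5 + a₆ * (4 * π) ^ 6)]
  have hz : ∀ n, 4 * π ≤ thetaFreq x (n + 1) := fun n =>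
    le_trans (by nlinarith) (four_mul_le_thetaFreq_succ hx0.le n)
  have hterm : ∀ n, |phiPolyTerm6 a₁ a₂ a₃ a₄ a₅ a₆ x (n + 1)| ≤
      C * (thetaFreq x (n + 1) ^ d * rexp (-thetaFreq x (n + 1))) := by
    intro n
    have h := hP _ (hz n)
    have he := (Real.exp_pos (-thetaFreq x (n + 1))).le
    unfold phiPolyTerm6
    rw [abs_mul, abs_of_nonneg he, ← mul_assoc]
    exact mul_le_mul_of_nonneg_right h he
  have hup : ∑' n, phiPolyTerm6 a₁ a₂ a₃ a₄ a₅ a₆ x (n + 1) ≤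
      C * ∑' n, thetaFreq x (n + 1) ^ d * rexp (-thetaFreq x (n + 1)) := by
    rw [← tsum_mul_left]
    exact hs.tsum_le_tsum (fun n => (le_abs_self _).trans (hterm n)) (hsum.mul_left C)
  have hlo : -(C * ∑' n, thetaFreq x (n + 1) ^ d * rexp (-thetaFreq x (n + 1))) ≤
      ∑' n, phiPolyTerm6 a₁ a₂ a₃ a₄ a₅ a₆ x (n + 1) := by
    rw [← tsum_mul_left, ← tsum_neg]
    exact (hsum.mul_left C).neg.tsum_le_tsum (fun n => by
      have := (neg_abs_le _).trans' (neg_le_neg (hterm n))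
      linarith) hs
  have hCle : C * ∑' n, thetaFreq x (n + 1) ^ d * rexp (-thetaFreq x (n + 1)) ≤
      C * (64 / 63 * 4 ^ d * ((π * x) ^ d * rexp (-(4 * (π * x))))) := mul_le_mul_of_nonneg_left hle hC
  exact abs_le.2 ⟨by linarith, by linarith⟩

/-! ## 2. Sizes of the one-series polynomials `P₀, …, P₄` on `z ≥ 4π` and the five tails -/

/-- `|P₀(z)| ≤ 2z²` for `z ≥ 4π`, `P₀(z) = 2z² − 3z` (the one-series polynomial of `Φ`). -/
theorem abs_P0_le {z : ℝ} (hz : 4 * π ≤ z) :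
    |(-3) * z + 2 * z ^ 2 + 0 * z ^ 3 + 0 * z ^ 4 + 0 * z ^ 5 + 0 * z ^ 6| ≤ 2 * z ^ 2 := by
  have hπ := Real.pi_gt_d2
  have hz12 : 12 ≤ z := by linarith
  refine abs_le.2 ⟨?_, ?_⟩ <;> nlinarith

/-- `|P₁(z)| ≤ 8z³` for `z ≥ 4π`, `−P₁(z) = 8z³ − 30z² + 15z` (the one-series polynomial of `−Φ′`). -/
theorem abs_P1_le {z : ℝ} (hz : 4 * π ≤ z) :
    |15 * z + (-30) * z ^ 2 + 8 * z ^ 3 + 0 * z ^ 4 + 0 * z ^ 5 + 0 * z ^ 6| ≤ 8 * z ^ 3 := by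
  have hπ := Real.pi_gt_d2
  have hz12 : 12 ≤ z := by linarith
  have hz0 : 0 ≤ z := by linarith
  have h1 : 0 ≤ 8 * z - 30 := by linarith
  refine abs_le.2 ⟨?_, ?_⟩ <;> nlinarith [mul_nonneg (sq_nonneg z) h1, sq_nonneg z]

/-- `|P₂(z)| ≤ 32z⁴` for `z ≥ 4π`, `P₂(z) = 32z⁴ − 224z³ + 330z² − 75z` (the one-series polynomial of `Φ″`). -/
theorem abs_P2_le {z : ℝ} (hz : 4 * π ≤ z) :
    |(-75) * z + 330 * z ^ 2 + (-224) * z ^ 3 + 32 * z ^ 4 + 0 * z ^ 5 + 0 * z ^ 6| ≤ 32 * z ^ 4 := by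
  have hπ := Real.pi_gt_d2
  have hz12 : 12 ≤ z := by linarith
  have hz0 : 0 ≤ z := by linarith
  have hz2 : 0 ≤ z ^ 2 := sq_nonneg z
  have hz3 : 0 ≤ z ^ 3 := by positivity
  have h1 : 0 ≤ 32 * z - 224 := by linarith
  have h2 : 0 ≤ 330 * z - 75 := by linarith
  have h3 : 0 ≤ 224 * z - 330 := by linarith
  refine abs_le.2 ⟨?_, ?_⟩
  · nlinarith [mul_nonneg hz3 h1, mul_nonneg hz0 h2]
  · nlinarith [mul_nonneg hz2 h3]

/-- `|P₃(z)| ≤ 128z⁵` for `z ≥ 4π`, `P₃(z) = −128z⁵ + 1440z⁴ − 4232z³ + 3270z² − 375z` (the one-series polynomial of `Φ‴`). -/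
theorem abs_P3_le {z : ℝ} (hz : 4 * π ≤ z) :
    |(-375) * z + 3270 * z ^ 2 + (-4232) * z ^ 3 + 1440 * z ^ 4 + (-128) * z ^ 5 + 0 * z ^ 6| ≤ 128 * z ^ 5 := by
  have hπ := Real.pi_gt_d2
  have hz12 : 12 ≤ z := by linarith
  have hz0 : 0 ≤ z := by linarith
  have hz2 : 0 ≤ z ^ 2 := sq_nonneg z
  have hz3 : 0 ≤ z ^ 3 := by positivity
  refine abs_le.2 ⟨?_, ?_⟩
  · -- `P₃(z) ≥ −128z⁵`: `1440z⁴ − 4232z³ + 3270z² − 375z ≥ 0`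
    have h1 : 0 ≤ 1440 * z - 4232 := by linarith
    have h2 : 0 ≤ 3270 * z - 375 := by linarith
    nlinarith [mul_nonneg hz3 h1, mul_nonneg hz0 h2]
  · -- `P₃(z) ≤ 0 ≤ 128z⁵`: `128z⁵ − 1440z⁴ = 128z⁴(z − 11.25) ≥ 0`, `4232z³ − 3270z² ≥ 0`
    have h1 : 0 ≤ 128 * z - 1440 := by linarith
    have h2 : 0 ≤ 4232 * z - 3270 := by linarith
    have hz4 : 0 ≤ z ^ 4 := by positivity
    have hz5 : 0 ≤ z ^ 5 := by positivity
    nlinarith [mul_nonneg hz4 h1, mul_nonneg hz2 h2]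

/-- `|P₄(z)| ≤ 512z⁶` for `z ≥ 4π`, `P₄(z) = 512z⁶ − 8448z⁵ + 41408z⁴ − 68096z³ + 30930z² − 1875z` (the one-series
polynomial of `Φ⁗`; `0 ≤ P₄` there since `512z² − 8448z + 41408 > 6559` and `6559z ≥ 68096 + 1875/z²`). -/
theorem abs_P4_le {z : ℝ} (hz : 4 * π ≤ z) :
    |(-1875) * z + 30930 * z ^ 2 + (-68096) * z ^ 3 + 41408 * z ^ 4 + (-8448) * z ^ 5 + 512 * z ^ 6| ≤
      512 * z ^ 6 := by
  have hπ := Real.pi_gt_d2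
  have hz12 : 12.56 ≤ z := by linarith
  have hz0 : 0 ≤ z := by linarith
  have hz2 : 0 ≤ z ^ 2 := sq_nonneg z
  have hz3 : 0 ≤ z ^ 3 := by positivity
  have hz4 : 0 ≤ z ^ 4 := by positivity
  refine abs_le.2 ⟨?_, ?_⟩
  · -- `P₄ ≥ 0 ≥ −512z⁶`: `z⁴(512z² − 8448z + 41408) ≥ 6559z⁴ ≥ 82000z³ ≥ 68096z³ + 1875z`
    have hq : 6559 ≤ 512 * z ^ 2 - 8448 * z + 41408 := by nlinarith [sq_nonneg (z - 8.25)]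
    have h1 : 6559 * z ^ 4 ≤ z ^ 4 * (512 * z ^ 2 - 8448 * z + 41408) := by nlinarith
    have h2 : 68096 * z ^ 3 + 1875 * z ≤ 6559 * z ^ 4 := by nlinarith
    have hz6 : 0 ≤ z ^ 6 := by positivity
    nlinarith
  · -- `P₄ ≤ 512z⁶`: `8448z⁵ − 41408z⁴ ≥ 0`, `68096z³ − 30930z² ≥ 0`, `1875z ≥ 0`
    have h1 : 0 ≤ 8448 * z - 41408 := by linarith
    have h2 : 0 ≤ 68096 * z - 30930 := by linarith
    nlinarith [mul_nonneg hz4 h1, mul_nonneg hz2 h2]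

/-- Tail of `Φ‴`: `|∑_{n≥1} P₃(y_n)e^{−y_n}| ≤ 128·(64/63)·4⁵·y⁵e^{−4y}`, `x ≥ 1`, `y = πx`. -/
theorem abs_tsum_phiPolyTerm6_P3_succ_le {x : ℝ} (hx : 1 ≤ x) :
    |∑' n, phiPolyTerm6 (-375) 3270 (-4232) 1440 (-128) 0 x (n + 1)| ≤
      128 * (64 / 63 * 4 ^ 5 * ((π * x) ^ 5 * rexp (-(4 * (π * x))))) :=
  abs_tsum_phiPolyTerm6_succ_le hx _ _ _ _ _ _ 128 (by norm_num) fun _ hz => abs_P3_le hz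

/-- Tail of `Φ⁗`: `|∑_{n≥1} P₄(y_n)e^{−y_n}| ≤ 512·(64/63)·4⁶·y⁶e^{−4y}`, `x ≥ 1`, `y = πx`. -/
theorem abs_tsum_phiPolyTerm6_P4_succ_le {x : ℝ} (hx : 1 ≤ x) :
    |∑' n, phiPolyTerm6 (-1875) 30930 (-68096) 41408 (-8448) 512 x (n + 1)| ≤
      512 * (64 / 63 * 4 ^ 6 * ((π * x) ^ 6 * rexp (-(4 * (π * x))))) :=
  abs_tsum_phiPolyTerm6_succ_le hx _ _ _ _ _ _ 512 le_rfl fun _ hz => abs_P4_le hz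

/-- The degree-four one-series, shifted by one, as degree-six series. -/
theorem tsum_phiPolyTerm_succ_eq_phiPolyTerm6 (a₁ a₂ a₃ a₄ x : ℝ) :
    ∑' n, phiPolyTerm a₁ a₂ a₃ a₄ x (n + 1) = ∑' n, phiPolyTerm6 a₁ a₂ a₃ a₄ 0 0 x (n + 1) :=
  tsum_congr fun n => phiPolyTerm_eq_phiPolyTerm6 a₁ a₂ a₃ a₄ x (n + 1)

/-- Tail of `Φ`: `|∑_{n≥1} P₀(y_n)e^{−y_n}| ≤ 2·(64/63)·4²·y²e^{−4y}`, `x ≥ 1`, `y = πx`. -/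
theorem abs_tsum_phiPolyTerm_P0_succ_le {x : ℝ} (hx : 1 ≤ x) :
    |∑' n, phiPolyTerm (-3) 2 0 0 x (n + 1)| ≤ 2 * (64 / 63 * 4 ^ 2 * ((π * x) ^ 2 * rexp (-(4 * (π * x))))) := by
  rw [tsum_phiPolyTerm_succ_eq_phiPolyTerm6]
  exact abs_tsum_phiPolyTerm6_succ_le hx _ _ _ _ _ _ 2 (by norm_num) fun _ hz => abs_P0_le hz

/-- Tail of `−Φ′`: `|∑_{n≥1} (−P₁)(y_n)e^{−y_n}| ≤ 8·(64/63)·4³·y³e^{−4y}`, `x ≥ 1`, `y = πx`. -/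
theorem abs_tsum_phiPolyTerm_P1_succ_le {x : ℝ} (hx : 1 ≤ x) :
    |∑' n, phiPolyTerm 15 (-30) 8 0 x (n + 1)| ≤ 8 * (64 / 63 * 4 ^ 3 * ((π * x) ^ 3 * rexp (-(4 * (π * x))))) := by
  rw [tsum_phiPolyTerm_succ_eq_phiPolyTerm6]
  exact abs_tsum_phiPolyTerm6_succ_le hx _ _ _ _ _ _ 8 (by norm_num) fun _ hz => abs_P1_le hz

/-- Tail of `Φ″`: `|∑_{n≥1} P₂(y_n)e^{−y_n}| ≤ 32·(64/63)·4⁴·y⁴e^{−4y}`, `x ≥ 1`, `y = πx`. -/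
theorem abs_tsum_phiPolyTerm_P2_succ_le {x : ℝ} (hx : 1 ≤ x) :
    |∑' n, phiPolyTerm (-75) 330 (-224) 32 x (n + 1)| ≤
      32 * (64 / 63 * 4 ^ 4 * ((π * x) ^ 4 * rexp (-(4 * (π * x))))) := by
  rw [tsum_phiPolyTerm_succ_eq_phiPolyTerm6]
  exact abs_tsum_phiPolyTerm6_succ_le hx _ _ _ _ _ _ 32 (by norm_num) fun _ hz => abs_P2_le hz

/-! ## 3. The heads at `n = 0` -/

/-- The `n = 0` frequency is `y_0 = πx`. -/
theorem thetaFreq_zero' (x : ℝ) : thetaFreq x 0 = π * x := by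
  simp [thetaFreq]

/-- The head of the series of `Φ″` in closed form: `P₂(y)e^{−y}`, `P₂(y) = 32y⁴ − 224y³ + 330y² − 75y`, `y = πx`. -/
theorem phiPolyTerm_zero_P2_eq (x : ℝ) :
    phiPolyTerm (-75) 330 (-224) 32 x 0 =
      (32 * (π * x) ^ 4 - 224 * (π * x) ^ 3 + 330 * (π * x) ^ 2 - 75 * (π * x)) * rexp (-(π * x)) := by
  simp only [phiPolyTerm, thetaFreq_zero']; ring

/-- The head of the series of `Φ‴` in closed form: `P₃(y)e^{−y}`. -/
theorem phiPolyTerm6_zero_P3_eq (x : ℝ) :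
    phiPolyTerm6 (-375) 3270 (-4232) 1440 (-128) 0 x 0 =
      (-128 * (π * x) ^ 5 + 1440 * (π * x) ^ 4 - 4232 * (π * x) ^ 3 + 3270 * (π * x) ^ 2 - 375 * (π * x)) *
        rexp (-(π * x)) := by
  simp only [phiPolyTerm6, thetaFreq_zero']; ring

/-- The head of the series of `Φ⁗` in closed form: `P₄(y)e^{−y}`. -/
theorem phiPolyTerm6_zero_P4_eq (x : ℝ) :
    phiPolyTerm6 (-1875) 30930 (-68096) 41408 (-8448) 512 x 0 =
      (512 * (π * x) ^ 6 - 8448 * (π * x) ^ 5 + 41408 * (π * x) ^ 4 - 68096 * (π * x) ^ 3 +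
          30930 * (π * x) ^ 2 - 1875 * (π * x)) * rexp (-(π * x)) := by
  simp only [phiPolyTerm6, thetaFreq_zero']; ring

/-- Splitting a one-series into head and tail: `∑_n f(n) = f(0) + ∑_n f(n+1)` for the degree-six generic term. -/
theorem tsum_phiPolyTerm6_eq_zero_add (a₁ a₂ a₃ a₄ a₅ a₆ : ℝ) {x : ℝ} (hx : 0 < x) :
    ∑' n, phiPolyTerm6 a₁ a₂ a₃ a₄ a₅ a₆ x n =
      phiPolyTerm6 a₁ a₂ a₃ a₄ a₅ a₆ x 0 + ∑' n, phiPolyTerm6 a₁ a₂ a₃ a₄ a₅ a₆ x (n + 1) :=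
  (summable_phiPolyTerm6 a₁ a₂ a₃ a₄ a₅ a₆ hx).tsum_eq_zero_add

end Summit.RiemannHypothesis.RiemannHypothesis.Theorems.JensenPolynomials

end
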